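import Mathlib
import Summits.Ventures.HodgeRepro.Tier4.Common.KTypeSpace
import Summits.Ventures.HodgeRepro.Tier4.Common.SettingOfData
import Summits.Ventures.HodgeRepro.Tier4.Line4.MaximalFamilyClosed
import Summits.Ventures.HodgeRepro.Tier4.Line4.W3OfRieszTypeClosed
import Summits.Ventures.HodgeRepro.Tier4.Line4.VanishingClause

/-!
# Tier4/Line4/W3OfRieszTypeBiequivariant — the L4 wall W3‴ from multiplicity one + BI-`(τ′,K)`-equivariant test
functions, on the closed constituents: `hvan` discharged by L4-p2's `hvan_of_right_equivariant`

Blind re-derivation cell `pub-hodge-repro`, Tier 4 «prove the step» (README §9–§10), seat t4-L4-p1 (prover, LINE L4,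
gen 3).  Tree path `lean/Summits/Ventures/HodgeRepro/Tier4/Line4/W3OfRieszTypeBiequivariant.lean`.

WHAT IS PROVED.  `mixed_two_torus_W3R_of_biequivariant_closed`: `W3OfRieszTypeClosed.mixed_two_torus_W3R_of_equivariant_closed`
with the clause `hvan` REPLACED by the right-`(τ′,K)`-equivariance of `f₁` (`f₁ (z κ) = conj (weight′ κ) · f₁ z` on
`localTorusAt' W w` at every infinite place, `f₁ (z κ) = f₁ z` on `K`) through t4-L4-p2 g3's
`VanishingClause.hvan_of_right_equivariant` (p687182).  The wall's residual in this display: `hfin` (Harish-Chandra on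
the closed constituents), `hmult` (multiplicity one of the `(τ′,K)`-type), `hadm` (the hit constituents are admissible),
`hJ` (`Jc(f₁ ⋆ f₂) ≠ 0`), and SIX displayed equivariance equations on the test pair — left-`(τ′,K)` for `f₁` and for
`cj (refl f₂)`, right-`(τ′,K)` for `f₁` — the bi-`(τ′,K)`-finite test class that typer-2's `kProj` is to produce
(C-L4-PROJ).  Nothing of the wall's content is proved.

Nothing here says anything about the status of the Hodge conjecture for CM abelian varieties, which is NOT proved
(HC_CM is NOT proved by anyone in this repository).
-/

set_option autoImplicit false

noncomputable section

namespace Summit.Ventures.HodgeRepro.Tier4.Line4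

open Summit.Ventures.HodgeRepro.Tier4.Common Summit.Ventures.HodgeRepro.Tier4.Line1 MeasureTheory NumberField
open scoped ComplexConjugate

section Biequivariant

variable {k : Type} [Field k] [NumberField k] (W : PlaneData k) [MeasurableSpace (GA W)] [BorelSpace (GA W)]
  (R : RTFData W) (μ : Measure (GA W)) [μ.IsHaarMeasure] [R.μT.IsHaarMeasure] [R.μT'.IsHaarMeasure]
  (DG : Set (GA W)) (fdG : IsFundamentalDomain (rationalPoints W) DG μ) (compG : IsCompact (closure DG))
  (compT : IsCompact (closure R.DT)) (compT' : IsCompact (closure R.DT'))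

/-- **W3‴ from multiplicity one + BI-`(τ′,K)`-equivariant test functions, on the CLOSED constituents**: the clauses
`ha`/`hb` of `mixed_two_torus_W3R_of_adapted_closed` replaced by `hmult` + the LEFT `T′`/`K`-equivariance of `f₁` and
`cj (refl f₂)`, and the clause `hvan` replaced by the RIGHT `T′`/`K`-equivariance of `f₁` (`h₁R`, `h₁KR`: L4-p2's
`hvan_of_right_equivariant`).  Residual: `hfin`, `hmult`, `hadm`, `hJ` + six displayed equivariance equations. -/
theorem mixed_two_torus_W3R_of_biequivariant_closed (hc : Continuous R.chi) (hu : ∀ a, ‖R.chi a‖ = 1)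
    (hc' : Continuous R.chi') (hunit' : ∀ t, ‖R.chi' t‖ = 1)
    (q : QuadData k) (g g' : Matrix (Fin 4) (Fin 4) k) (w₀ : InfinitePlace k)
    (eP eM eP' eM' : InfinitePlace k → ℤ)
    (K : Subgroup (GA W)) (hK : IsCompactOpenIn W (finitePart W) K)
    (hfin : ∀ U : Set (GA W → ℂ), (Setting.ofAdelicData W R μ DG fdG compG compT compT').IsIrrNonzero U →
      IsClosedSub (Setting.ofAdelicData W R μ DG fdG compG compT compT') U →
      FiniteDimensional ℂ (kTypeSpace' W q g g' eP' eM' K (Submodule.span ℂ U)))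
    (hmult : ∀ U : Set (GA W → ℂ), (Setting.ofAdelicData W R μ DG fdG compG compT compT').IsIrrNonzero U →
      IsClosedSub (Setting.ofAdelicData W R μ DG fdG compG compT compT') U →
      ∃ v : GA W → ℂ, kTypeSpace' W q g g' eP' eM' K (Submodule.span ℂ U) ≤ Submodule.span ℂ {v})
    {f₁ f₂ : GA W → ℂ} (h₁ : IsTestFn W f₁) (h₂ : IsTestFn W f₂)
    (h₁T' : ∀ (w : InfinitePlace k) (κ : GA W), κ ∈ localTorusAt' W w → ∀ y,
      f₁ (κ⁻¹ * y) = weightAt' W q w g g' 0 κ ^ eP' w * weightAt' W q w g g' 1 κ ^ eM' w * f₁ y)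
    (h₁K : ∀ κ ∈ K, ∀ y, f₁ (κ⁻¹ * y) = f₁ y)
    (h₂T' : ∀ (w : InfinitePlace k) (κ : GA W), κ ∈ localTorusAt' W w → ∀ y,
      RTF.cj (RTF.refl f₂) (κ⁻¹ * y) =
        weightAt' W q w g g' 0 κ ^ eP' w * weightAt' W q w g g' 1 κ ^ eM' w * RTF.cj (RTF.refl f₂) y)
    (h₂K : ∀ κ ∈ K, ∀ y, RTF.cj (RTF.refl f₂) (κ⁻¹ * y) = RTF.cj (RTF.refl f₂) y)
    (h₁R : ∀ (w : InfinitePlace k) (κ : GA W), κ ∈ localTorusAt' W w → ∀ z,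
      f₁ (z * κ) = conj (weightAt' W q w g g' 0 κ ^ eP' w * weightAt' W q w g g' 1 κ ^ eM' w) * f₁ z)
    (h₁KR : ∀ κ ∈ K, ∀ z, f₁ (z * κ) = f₁ z)
    (hadm : ∀ U : Set (GA W → ℂ), (Setting.ofAdelicData W R μ DG fdG compG compT compT').IsIrrNonzero U →
      IsClosedSub (Setting.ofAdelicData W R μ DG fdG compG compT compT') U →
      ∀ a : ℂ, a ≠ 0 →
      (∃ ψ ∈ kTypeSpace' W q g g' eP' eM' K (Submodule.span ℂ U), ψ ≠ 0 ∧
        rightRegular W μ (RTF.cj f₁) (fun x => conj (ψ x)) = fun x => a * conj (ψ x)) →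
      IsAdmissibleS W (Setting.ofAdelicData W R μ DG fdG compG compT compT') q g g' w₀ eP eM eP' eM'
        (Submodule.span ℂ U))
    (hJ : R.Jc ((Setting.ofAdelicData W R μ DG fdG compG compT compT').conv f₁ f₂) ≠ 0) :
    ∃ V₀ : Submodule ℂ (GA W → ℂ),
      IsAdmissibleS W (Setting.ofAdelicData W R μ DG fdG compG compT compT') q g g' w₀ eP eM eP' eM' V₀ ∧
      ∃ K₀ : Subgroup (GA W), IsCompactOpenIn W (finitePart W) K₀ ∧
        FiniteDimensional ℂ (kTypeSpace' W q g g' eP' eM' K₀ V₀) ∧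
        ∃ f : GA W → ℂ, IsRieszVectorOn R μ DG (kTypeSpace' W q g g' eP' eM' K₀ V₀) f ∧
          periodLin W R.μT R.DT R.chi (restrictTo W (torusT W) f) ≠ 0 :=
  mixed_two_torus_W3R_of_equivariant_closed W R μ DG fdG compG compT compT' hc hu hc' hunit' q g g' w₀ eP eM eP' eM'
    K hK hfin hmult h₁ h₂ h₁T' h₁K h₂T' h₂K
    (fun U hU _ ψ hψ hperp =>
      hvan_of_right_equivariant W R μ DG fdG compG compT compT' q g g' eP' eM' K h₁ h₁R h₁KR U hU ψ hψ hperp)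
    hadm hJ

end Biequivariant

end Summit.Ventures.HodgeRepro.Tier4.Line4

end
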